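import Summits.QuantumFields.BalabanUV.T4Continuum.Support.VariationalCovariantRate
import Summits.QuantumFields.BalabanUV.T4Continuum.Support.VariationalCovariantTowerLaw
import Summits.QuantumFields.BalabanUV.T4Continuum.Support.VariationalCovariantScalarPairClosed

/-!
# T⁴ programme, spine node NE2 (U1a), lane P2 — THE END OF THE VARIATIONAL ROUTE'S BACKGROUND TIER (scalar covariant species):
# the η-RATE `TowerLimitRate (fun _ ↦ 1) 1 (k ↦ X_k) C L⁻¹` of the effective covariant Laplacians `X_k = effSc (L^k) M (Rc k) (T k) a₀`
# with EVERY LEAF DISCHARGED — binders = DATA + CLASS + COMP⁺ only (road owner `b2b-balaban-t4-ne2-p2` gen 11; `t4/skeletons/NE2-t4-ne2-p2.md`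
# v0.9 §0 target R⁺ / §3 assembly; journal CLAIM «P2-END» CLAIMS.log l.9264)

HONEST FRAMING (T4-DAG p. 1).  Rung (B)+1 only — NOT infinite volume, NOT a mass gap, NOT Clay.  Node NE2 is NOT IN PRINT and NOT
proved here.  MODEL LEVEL: U(1) bond phases, unit-modulus site transports, global unitary frames and the defect data are DATA (King's
charged scalar = the (2.14) species WITH background; [B9] (3.3)/(3.19)/(3.23) SHAPES); the identification with Bałaban's `U_k(V)`, `Q̄`,
`Γ^{(j)}_{y,x}` and the size of the defects for HIS minimisers are the b05/b09/an2 lineages' dictionary, NOT asserted here; scalar (0-form)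
sector; global small field.  What is proved is [folklore] plumbing over tree theorems, every leaf imported BY NAME: the per-level CLOSED
bracket `VariationalCovariantScalarPairClosed.scalar_pair_closed` (leaf-09-g3 p213521; inside it UB⁺ `VariationalCovariantUpperBound.
exists_ub_scalarPair` leaf-04-g2 p212172, ONE⁺ `VariationalCovariantOneStepPhys.blockSpin_Q1_le` leaf-01-g2 p213246, REG⁺
`VariationalCovariantRegularityRho.hREG_rho` leaf-09-g3 p213112, the fine UB⁺ step `VariationalCovariantUpperSqrt.fine_ub_of_coarse_sqrt`
leaf-01-g2 p213284, FED⁺ `Sc_Q1_le` / P⁺ `qW_le_coarse`, `qV_le_composite` / assembly `scalar_pair_bracket_sqrt` — the owner's p210720 /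
p211276 / p211992 and leaf-01-g2's p212859), COMP⁺ and the tower `VariationalCovariantTower` (leaf-02-g3 p213109), the defect functions
`eFED`/`eONE`/`eUB` of `VariationalCovariantTowerLaw` (leaf-02-g3 p213485), and the rate lemmas of `VariationalCovariantRate` (this seat).
Nothing printed is a hypothesis; no `def … : Prop` fact; no `sorry`; axioms standard.  NE2 NOT proved.
HONEST DEPENDENCY (cell, verbatim): continuum YM on T⁴ ⇐ BetaPertH ∧ nine spine estimates (0/9 proved); BetaPertH ⇐ (D1) ∧ (D4) ∧
CAP+tail; G-an2-4 gates asym, D1 and NE2/3/4.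

CONTENTS.
* §3 the per-level constants of the CLOSED bracket packaged as real functions `lamC`, `cR`, `lamF`, `delta`, `eps1`, `deltaP`, `lamLevel`,
  **`eLevel`**, **`ePLevel`** (LITERALLY the `let`s of `scalar_pair_closed`; `eFED`/`eONE`/`eUB` are leaf-02-g3's, BY NAME), the k-uniform
  constants `lamStar`, **`cEnd`** under the CLASS bounds, `level_defects_le : e_k, e′_k ≤ cEnd·(L⁻¹)^k`, and **`towerLimitRate_of_closedBrackets`**:
  closed per-level brackets (hypothesis family, defects `eLevel`/`ePLevel` at `n = L^k`) + CLASS + COMP⁺ ⟹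
  `TowerLimitRate (fun _ ↦ 1) 1 (k ↦ effSc (L^k) M (Rc k) (T k) a₀) (cEnd d L c_w c_a c_m c₁) L⁻¹`.
* §4 **`towerLimitRate_scalarTower_closed` — THE END**: the bracket family DISCHARGED level by level by `scalar_pair_closed`: binders = DATA
  (unit-modulus transports and phases, frames with the global small-field absorptions, the four defect families) + CLASS + COMP⁺ + `2 ≤ L`,
  `0 < a₀` ONLY.  NO leaf binder, NO NE3 — the route's target R⁺ of the skeleton §0 for the scalar covariant species at the canonical pair,
  RATE `θ = L⁻¹` (first order in the field strength through the one-block transport mismatch; numerics N-ne2p2g10-1).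
-/

noncomputable section

open scoped Matrix ComplexConjugate ComplexOrder Matrix.Norms.L2Operator BigOperators

namespace Summit.QuantumFields.BalabanUV.T4Continuum.VariationalCovariantEnd

open Summit.QuantumFields.BalabanUV.T4Continuum.VariationalTransfer (blockSpin)
open Summit.QuantumFields.BalabanUV.T4Continuum.VariationalCovariantEffective (effSc)
open Summit.QuantumFields.BalabanUV.T4Continuum.VariationalCovariantTower (compT Rtr)
open Summit.QuantumFields.BalabanUV.T4Continuum.VariationalCovariantTowerLaw (eFED eONE eUB eFED_nonneg eONE_nonneg eUB_nonneg)
open Summit.QuantumFields.BalabanUV.T4Continuum.VariationalCovariantScalarPairClosed (scalar_pair_closed)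
open Summit.QuantumFields.BalabanUV.T4Continuum.VariationalCovariantRate
open Summit.QuantumFields.BalabanUV.T4Continuum.CovariantAveragingTower (TowerLimitRate)
open Summit.QuantumFields.BalabanUV.T4Continuum.VariationalCovariantFederbush (mis)
open Literature.MathematicalPhysics.QuantumFieldTheory.Balaban1983to89.B5Prop11Lower (nsq nsq_nonneg)
open Literature.MathematicalPhysics.QuantumFieldTheory.Balaban1983to89.B5Prop11Plancherel (Tor fine unitVec)
open Literature.MathematicalPhysics.QuantumFieldTheory.Balaban1983to89.B5Block118 (bpt)
open Summit.QuantumFields.BalabanUV.T4Continuum.VariationalCovariantScalarPair (Sc Sf qW Qk Q1 qW_le_coarse)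

/-! ## §3 The END under the CLASS hypotheses: rate `L⁻¹` with an explicit constant

The per-level constants of the closed bracket are packaged as real functions (small terms; the fully expanded expressions exceed the
elaborator's recursion budget), LITERALLY the `let`s of `VariationalCovariantScalarPairClosed.scalar_pair_closed` (`C_P = 1088d + 128`
inlined as there); the two defects `eFED`, `eONE` and the UB⁺ increment `eUB` are leaf-02-g3's (`VariationalCovariantTowerLaw`, BY NAME). -/

section Constants

/-- UB⁺ constant `Λc = 2d·36^d·((1 + x)² + 9)` at in-block defect size `x = n·w` (`VariationalCovariantUpperBound.exists_ub_scalarPair`). [folklore] -/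
def lamC (d : ℕ) (x : ℝ) : ℝ := 2 * (d : ℝ) * (36 : ℝ) ^ d * ((1 + x) ^ 2 + 9)

/-- REG⁺ constant `C_R = 2Λc + 2d·α + d²·α²·C_P` at plaquette size `α = a·n²` (`VariationalCovariantRegularityRho.hREG_rho`). [folklore] -/
def cR (d : ℕ) (Λc α : ℝ) : ℝ := 2 * Λc + 2 * (d : ℝ) * α + (d : ℝ) ^ 2 * α ^ 2 * (1088 * (d : ℝ) + 128)

/-- fine-member UB⁺ constant `Λ = Λc + ẽ·(Λc+1)`, `ẽ = eUB d C_R ε₁ δ′` (`VariationalCovariantUpperSqrt.fine_ub_of_coarse_sqrt`). [folklore] -/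
def lamF (d : ℕ) (Λc CR ε₁ δ' : ℝ) : ℝ := Λc + eUB d CR ε₁ δ' * (Λc + 1)

/-- FED⁺ mismatch parameter `δ = √d·(n·m)`. [folklore] -/
def delta (d : ℕ) (n m : ℝ) : ℝ := Real.sqrt (d : ℝ) * (n * m)

/-- ONE⁺ consistency parameter `ε₁ = (d/4 + ½)·(L/n²)`. [folklore] -/
def eps1 (d L : ℕ) (n : ℝ) : ℝ := ((d : ℝ) / 4 + 1 / 2) * ((L : ℝ) / n ^ 2)

/-- ONE⁺ transport parameter `δ′ = √(2d(1+d²))·(n·L·m₁)`. [folklore] -/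
def deltaP (d L : ℕ) (n m₁ : ℝ) : ℝ := Real.sqrt (2 * (d : ℝ) * (1 + (d : ℝ) ^ 2)) * (n * (L : ℝ) * m₁)

/-- the fine UB⁺ constant at level size `n` with defect data `(w, a, m₁)`. [folklore] -/
def lamLevel (d L : ℕ) (n w a m₁ : ℝ) : ℝ :=
  lamF d (lamC d (n * w)) (cR d (lamC d (n * w)) (a * n ^ 2)) (eps1 d L n) (deltaP d L n m₁)

/-- the FED⁺-side defect `e_k` of the closed bracket at level size `n` with defect data `(w, a, m, m₁)`. [folklore] -/
def eLevel (d L : ℕ) (n w a m m₁ : ℝ) : ℝ := eFED d (delta d n m) (lamLevel d L n w a m₁)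

/-- the ONE⁺/REG⁺-side defect `e′_k` of the closed bracket at level size `n` with defect data `(w, a, m₁)`. [folklore] -/
def ePLevel (d L : ℕ) (n w a m₁ : ℝ) : ℝ :=
  eONE d (lamLevel d L n w a m₁) (cR d (lamC d (n * w)) (a * n ^ 2)) (eps1 d L n) (deltaP d L n m₁)

/-- the k-uniform fine UB⁺ constant `Λ⋆(d, L, c_w, c_a, c₁)` under the CLASS bounds. [folklore] -/
def lamStar (d L : ℕ) (cw ca c₁ : ℝ) : ℝ :=
  lamF d (lamC d cw) (cR d (lamC d cw) ca) (((d : ℝ) / 4 + 1 / 2) * (L : ℝ)) (Real.sqrt (2 * (d : ℝ) * (1 + (d : ℝ) ^ 2)) * (L : ℝ) * c₁)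

/-- **THE RATE CONSTANT OF THE END** `C(d, L, c_w, c_a, c_m, c₁) = eFED(√d·c_m, Λ⋆) + eONE(Λ⋆, C_R⋆, (d/4+½)L, √(2d(1+d²))·L·c₁)`. [folklore] -/
def cEnd (d L : ℕ) (cw ca cm c₁ : ℝ) : ℝ :=
  eFED d (Real.sqrt (d : ℝ) * cm) (lamStar d L cw ca c₁)
    + eONE d (lamStar d L cw ca c₁) (cR d (lamC d cw) ca) (((d : ℝ) / 4 + 1 / 2) * (L : ℝ))
        (Real.sqrt (2 * (d : ℝ) * (1 + (d : ℝ) ^ 2)) * (L : ℝ) * c₁)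

/-- `0 ≤ C_P`. [folklore] -/
theorem cP_nonneg (d : ℕ) : (0 : ℝ) ≤ 1088 * (d : ℝ) + 128 := by positivity

/-- `0 ≤ Λc`. [folklore] -/
theorem lamC_nonneg (d : ℕ) (x : ℝ) : 0 ≤ lamC d x := by unfold lamC; positivity

/-- `0 ≤ C_R`. [folklore] -/
theorem cR_nonneg (d : ℕ) {Λc α : ℝ} (hΛ : 0 ≤ Λc) (hα : 0 ≤ α) : 0 ≤ cR d Λc α := by
  unfold cR; positivity

/-- `0 ≤ Λ` (fine member). [folklore] -/
theorem lamF_nonneg (d : ℕ) {Λc CR ε₁ δ' : ℝ} (hΛ : 0 ≤ Λc) (hCR : 0 ≤ CR) (hε : 0 ≤ ε₁) (hδ : 0 ≤ δ') : 0 ≤ lamF d Λc CR ε₁ δ' := by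
  have := eUB_nonneg d hCR hε hδ; unfold lamF; positivity

/-- `0 ≤ Λ⋆` for nonnegative class constants. [folklore] -/
theorem lamStar_nonneg (d L : ℕ) {cw ca c₁ : ℝ} (hca : 0 ≤ ca) (hc₁ : 0 ≤ c₁) : 0 ≤ lamStar d L cw ca c₁ := by
  unfold lamStar
  exact lamF_nonneg d (lamC_nonneg d cw) (cR_nonneg d (lamC_nonneg d cw) hca) (by positivity) (by positivity)

/-- `0 ≤ C`. [folklore] -/
theorem cEnd_nonneg (d L : ℕ) {cw ca cm c₁ : ℝ} (hca : 0 ≤ ca) (hcm : 0 ≤ cm) (hc₁ : 0 ≤ c₁) : 0 ≤ cEnd d L cw ca cm c₁ := by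
  unfold cEnd
  exact add_nonneg (eFED_nonneg d (by positivity) (lamStar_nonneg d L hca hc₁))
    (eONE_nonneg d (lamStar_nonneg d L hca hc₁) (cR_nonneg d (lamC_nonneg d cw) hca) (by positivity) (by positivity))

end Constants

section End

variable {d : ℕ} (L : ℕ) [NeZero L] (M : Fin d → ℕ) [hM : ∀ μ, NeZero (M μ)]
variable (Rc : (k : ℕ) → Tor (fine (L ^ k) M) → Fin d → ℂ) (T : (k : ℕ) → Tor (fine (L ^ k) M) → ℂ)
variable (R' : (k : ℕ) → Tor (fine L (fine (L ^ k) M)) → Fin d → ℂ) (T' : (k : ℕ) → Tor (fine L (fine (L ^ k) M)) → ℂ)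

omit [NeZero L] in
/-- `1 ≤ L^k`, `(L^k)⁻¹ = (L⁻¹)^k`, `0 ≤ (L⁻¹)^k ≤ 1` as reals, for `1 ≤ L`. [folklore] -/
theorem level_facts (hL1 : (1 : ℝ) ≤ L) (k : ℕ) : (1 : ℝ) ≤ (((L ^ k : ℕ)) : ℝ) ∧ ((((L ^ k : ℕ)) : ℝ))⁻¹ = ((L : ℝ)⁻¹) ^ k ∧
    (0 : ℝ) ≤ ((L : ℝ)⁻¹) ^ k ∧ ((L : ℝ)⁻¹) ^ k ≤ 1 := by
  have h1 : (1 : ℝ) ≤ (((L ^ k : ℕ)) : ℝ) := by push_cast; exact one_le_pow₀ hL1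
  have hL0 : (0 : ℝ) ≤ L := by linarith
  refine ⟨h1, by push_cast; rw [inv_pow], by positivity, ?_⟩
  exact pow_le_one₀ (by positivity) (inv_le_one_of_one_le₀ hL1)

omit [NeZero L] in
/-- **PER-LEVEL RATE BOUNDS UNDER THE CLASS HYPOTHESES**: at level `n = L^k`, `n·w ≤ c_w`, `a·n² ≤ c_a`, `n²·m ≤ c_m`, `n²·m₁ ≤ c₁`
(`w, a, m, m₁ ≥ 0`, `1 ≤ L`) ⟹ `e_k ≤ C·(L⁻¹)^k` and `e′_k ≤ C·(L⁻¹)^k`, `C = cEnd d L c_w c_a c_m c₁`. [folklore] -/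
theorem level_defects_le (hL1 : (1 : ℝ) ≤ L) (k : ℕ) {w a m m₁ cw ca cm c₁ : ℝ}
    (hw : 0 ≤ w) (hwc : (((L ^ k : ℕ)) : ℝ) * w ≤ cw) (ha : 0 ≤ a) (hac : a * (((L ^ k : ℕ)) : ℝ) ^ 2 ≤ ca)
    (hm : 0 ≤ m) (hmc : (((L ^ k : ℕ)) : ℝ) ^ 2 * m ≤ cm) (hm₁ : 0 ≤ m₁) (hm₁c : (((L ^ k : ℕ)) : ℝ) ^ 2 * m₁ ≤ c₁) :
    eLevel d L (((L ^ k : ℕ)) : ℝ) w a m m₁ ≤ cEnd d L cw ca cm c₁ * ((L : ℝ)⁻¹) ^ k ∧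
      ePLevel d L (((L ^ k : ℕ)) : ℝ) w a m₁ ≤ cEnd d L cw ca cm c₁ * ((L : ℝ)⁻¹) ^ k := by
  obtain ⟨hn1, hninv, ht0, ht1⟩ := level_facts L hL1 k
  set n : ℝ := (((L ^ k : ℕ)) : ℝ) with hn
  have hL0 : (0 : ℝ) ≤ L := by linarith
  have hn0 : (0 : ℝ) ≤ n := by linarith
  have hCP : (0 : ℝ) ≤ 1088 * (d : ℝ) + 128 := cP_nonneg d
  -- class constants are nonnegative
  have hcw : 0 ≤ cw := le_trans (mul_nonneg hn0 hw) hwc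
  have hca : 0 ≤ ca := le_trans (mul_nonneg ha (by positivity)) hac
  have hcm : 0 ≤ cm := le_trans (mul_nonneg (by positivity) hm) hmc
  have hc₁ : 0 ≤ c₁ := le_trans (mul_nonneg (by positivity) hm₁) hm₁c
  -- per-level constants vs. starred constants
  have hΛc0 : 0 ≤ lamC d (n * w) := lamC_nonneg d _
  have hΛc : lamC d (n * w) ≤ lamC d cw := by unfold lamC; exact LamC_le (mul_nonneg hn0 hw) hwc
  have hα0 : 0 ≤ a * n ^ 2 := by positivity
  have hCR0 : 0 ≤ cR d (lamC d (n * w)) (a * n ^ 2) := cR_nonneg d hΛc0 hα0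
  have hCR : cR d (lamC d (n * w)) (a * n ^ 2) ≤ cR d (lamC d cw) ca := by unfold cR; exact CR_le hΛc hα0 hac hCP
  have hE1 : 0 ≤ ((d : ℝ) / 4 + 1 / 2) * (L : ℝ) := by positivity
  have hε0 : 0 ≤ eps1 d L n := by unfold eps1; positivity
  have hε : eps1 d L n ≤ (((d : ℝ) / 4 + 1 / 2) * (L : ℝ)) * ((L : ℝ)⁻¹) ^ k := by
    rw [← hninv]; unfold eps1; exact eps1_le hn1 hL0
  have hεE : eps1 d L n ≤ ((d : ℝ) / 4 + 1 / 2) * (L : ℝ) := hε.trans (mul_le_of_le_one_right hE1 ht1)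
  have hDp : 0 ≤ Real.sqrt (2 * (d : ℝ) * (1 + (d : ℝ) ^ 2)) * (L : ℝ) * c₁ := by positivity
  have hδ'0 : 0 ≤ deltaP d L n m₁ := by unfold deltaP; positivity
  have hδ' : deltaP d L n m₁ ≤ (Real.sqrt (2 * (d : ℝ) * (1 + (d : ℝ) ^ 2)) * (L : ℝ) * c₁) * ((L : ℝ)⁻¹) ^ k := by
    rw [← hninv]; unfold deltaP; exact deltaPrime_le hn1 hL0 hm₁c
  have hδ'D : deltaP d L n m₁ ≤ Real.sqrt (2 * (d : ℝ) * (1 + (d : ℝ) ^ 2)) * (L : ℝ) * c₁ := hδ'.trans (mul_le_of_le_one_right hDp ht1)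
  have hD : 0 ≤ Real.sqrt (d : ℝ) * cm := by positivity
  have hδ0 : 0 ≤ delta d n m := by unfold delta; positivity
  have hδ : delta d n m ≤ (Real.sqrt (d : ℝ) * cm) * ((L : ℝ)⁻¹) ^ k := by
    rw [← hninv]; unfold delta; exact delta_le hn1 hmc
  have hΛ0 : 0 ≤ lamLevel d L n w a m₁ := by unfold lamLevel; exact lamF_nonneg d hΛc0 hCR0 hε0 hδ'0
  have hΛ : lamLevel d L n w a m₁ ≤ lamStar d L cw ca c₁ := by
    unfold lamLevel lamStar lamF eUB; exact lamFine_le hΛc0 hΛc hε0 hεE hδ'0 hδ'D hCR0 hCR hCP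
  have hΛs0 : 0 ≤ lamStar d L cw ca c₁ := hΛ0.trans hΛ
  have hCRs0 : 0 ≤ cR d (lamC d cw) ca := hCR0.trans hCR
  have h1 : eLevel d L n w a m m₁ ≤ eFED d (Real.sqrt (d : ℝ) * cm) (lamStar d L cw ca c₁) * ((L : ℝ)⁻¹) ^ k := by
    unfold eLevel eFED; exact eFED_le hδ0 hδ ht0 ht1 hΛ0 hΛ hCP
  have h2 : ePLevel d L n w a m₁ ≤ eONE d (lamStar d L cw ca c₁) (cR d (lamC d cw) ca) (((d : ℝ) / 4 + 1 / 2) * (L : ℝ))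
      (Real.sqrt (2 * (d : ℝ) * (1 + (d : ℝ) ^ 2)) * (L : ℝ) * c₁) * ((L : ℝ)⁻¹) ^ k := by
    unfold ePLevel eONE; exact eONE_le hε hE1 hδ'0 hδ' ht0 ht1 hΛ0 hΛ hCR0 hCR hCP
  have hF0 : 0 ≤ eFED d (Real.sqrt (d : ℝ) * cm) (lamStar d L cw ca c₁) := eFED_nonneg d hD hΛs0
  have hO0 : 0 ≤ eONE d (lamStar d L cw ca c₁) (cR d (lamC d cw) ca) (((d : ℝ) / 4 + 1 / 2) * (L : ℝ))
      (Real.sqrt (2 * (d : ℝ) * (1 + (d : ℝ) ^ 2)) * (L : ℝ) * c₁) := eONE_nonneg d hΛs0 hCRs0 hE1 hDp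
  constructor
  · refine h1.trans ?_
    unfold cEnd
    nlinarith
  · refine h2.trans ?_
    unfold cEnd
    nlinarith

/-- **THE END OF THE SCALAR COVARIANT CANONICAL-PAIR ROAD, FROM CLOSED PER-LEVEL BRACKETS**: if at every level `n = L^k` the
canonical-pair bracket holds with the EXPLICIT defects `eLevel` / `ePLevel` (= the `let`s of `VariationalCovariantScalarPairClosed.
scalar_pair_closed`: UB⁺ `Λc = 2d·36^d((1+nw)²+9)`, P⁺ `C_P = 1088d+128`, REG⁺ `C_R = 2Λc + 2d(an²) + d²(an²)²C_P`, ONE⁺ `ε₁ = (d/4+½)L/n²`,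
`δ′ = √(2d(1+d²))·(nLm₁)`, fine UB⁺ `Λ = Λc + (ε₁C_R + 2δ′√((1+ε₁C_R)C_P) + δ′²C_P)(Λc+1)`, FED⁺ `δ = √d·(nm)`), and the defect DATA obey the
CLASS bounds `n·w_k ≤ c_w`, `a_k·n² ≤ c_a`, `n²·m_k ≤ c_m`, `n²·m₁,k ≤ c₁` (k-uniform), then — with the COMP⁺ identities, unimodular
`T k` and per-level P⁺-shaped coercivity — the effective covariant Laplacians `X_k = effSc (L^k) M (Rc k) (T k) a₀` CONVERGE on the unit
torus at RATE `L⁻¹`: `TowerLimitRate (fun _ ↦ 1) 1 X (cEnd d L c_w c_a c_m c₁) L⁻¹` (`2 ≤ L`).  Nothing of NE3. [folklore] -/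
theorem towerLimitRate_of_closedBrackets (hL : 2 ≤ L) (hT : ∀ k x, ‖T k x‖ = 1) {CP' : ℕ → ℝ}
    (hPc : ∀ k f, qW (L ^ k) M f ≤ CP' k * (Sc (L ^ k) M (Rc k) f + nsq (Qk (L ^ k) M (T k) f)))
    (hTcomp : ∀ k, T (k + 1) = compT (L ^ k) L M (T k) (T' k)) (hRtr : ∀ k, Rc (k + 1) = Rtr (L ^ k) L M (R' k))
    {a₀ : ℝ} (ha₀ : 0 < a₀)
    (w a m m₁ : ℕ → ℝ) {cw ca cm c₁ : ℝ}
    (hw : ∀ k, 0 ≤ w k) (hwc : ∀ k, (((L ^ k : ℕ)) : ℝ) * w k ≤ cw)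
    (ha : ∀ k, 0 ≤ a k) (hac : ∀ k, a k * (((L ^ k : ℕ)) : ℝ) ^ 2 ≤ ca)
    (hm : ∀ k, 0 ≤ m k) (hmc : ∀ k, (((L ^ k : ℕ)) : ℝ) ^ 2 * m k ≤ cm)
    (hm₁ : ∀ k, 0 ≤ m₁ k) (hm₁c : ∀ k, (((L ^ k : ℕ)) : ℝ) ^ 2 * m₁ k ≤ c₁)
    (hbr : ∀ k μ, blockSpin (Qk (L ^ k) M (T k)) (Sc (L ^ k) M (Rc k)) μ
        ≤ blockSpin (Qk (L ^ k) M (T k) ∘ Q1 (L ^ k) L M (T' k)) (Sf (L ^ k) L M (R' k)) μ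
          + eLevel d L (((L ^ k : ℕ)) : ℝ) (w k) (a k) (m k) (m₁ k) * nsq μ ∧
      blockSpin (Qk (L ^ k) M (T k) ∘ Q1 (L ^ k) L M (T' k)) (Sf (L ^ k) L M (R' k)) μ
        ≤ blockSpin (Qk (L ^ k) M (T k)) (Sc (L ^ k) M (Rc k)) μ
          + ePLevel d L (((L ^ k : ℕ)) : ℝ) (w k) (a k) (m₁ k) * nsq μ) :
    TowerLimitRate (ι := fun _ => Tor M) (fun _ => (1 : Matrix (Tor M) (Tor M) ℂ)) 1
      (fun k => effSc (L ^ k) M (Rc k) (T k) a₀) (cEnd d L cw ca cm c₁) ((L : ℝ)⁻¹) := by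
  have hL2 : (2 : ℝ) ≤ L := by exact_mod_cast hL
  have hL1 : (1 : ℝ) ≤ L := by linarith
  have hρ0 : (0 : ℝ) ≤ (L : ℝ)⁻¹ := by positivity
  have hρ1 : (L : ℝ)⁻¹ < 1 := inv_lt_one_of_one_lt₀ (by linarith)
  have hca : 0 ≤ ca := le_trans (mul_nonneg (ha 0) (by positivity)) (hac 0)
  have hcm : 0 ≤ cm := le_trans (mul_nonneg (by positivity) (hm 0)) (hmc 0)
  have hc₁ : 0 ≤ c₁ := le_trans (mul_nonneg (by positivity) (hm₁ 0)) (hm₁c 0)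
  exact towerLimitRate_effSc_of_pairs L M Rc T R' T' hT hPc hTcomp hRtr ha₀ (cEnd_nonneg d L hca hcm hc₁) hρ0 hρ1
    (fun k => eLevel d L (((L ^ k : ℕ)) : ℝ) (w k) (a k) (m k) (m₁ k)) (fun k => ePLevel d L (((L ^ k : ℕ)) : ℝ) (w k) (a k) (m₁ k))
    (fun k => (level_defects_le L hL1 k (hw k) (hwc k) (ha k) (hac k) (hm k) (hmc k) (hm₁ k) (hm₁c k)).1)
    (fun k => (level_defects_le L hL1 k (hw k) (hwc k) (ha k) (hac k) (hm k) (hmc k) (hm₁ k) (hm₁c k)).2) hbr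

end End

/-! ## §4 THE END: every leaf discharged (`scalar_pair_closed` at every level), binders = DATA + CLASS + COMP⁺ only -/

section Closed

variable {d : ℕ} (L : ℕ) [NeZero L] (M : Fin d → ℕ) [hM : ∀ μ, NeZero (M μ)]
variable (Rc : (k : ℕ) → Tor (fine (L ^ k) M) → Fin d → ℂ) (T : (k : ℕ) → Tor (fine (L ^ k) M) → ℂ)
variable (R' : (k : ℕ) → Tor (fine L (fine (L ^ k) M)) → Fin d → ℂ) (T' : (k : ℕ) → Tor (fine L (fine (L ^ k) M)) → ℂ)
variable (G : (k : ℕ) → Tor (fine (L ^ k) M) → ℂ) (c : (k : ℕ) → Tor M → ℂ) (mG mB : ℕ → ℝ)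
variable (G' : (k : ℕ) → Tor (fine L (fine (L ^ k) M)) → ℂ) (c' : (k : ℕ) → Tor (fine (L ^ k) M) → ℂ) (mG' mB' : ℕ → ℝ)
variable (m w a m₁ : ℕ → ℝ)

/-- **THE END (P2, scalar covariant species, canonical pair, model level) — THE η-RATE WITH EVERY LEAF DISCHARGED.**  Tower data at
levels `n = L^k`: U(1) bond phases `Rc k` (unit modulus), unit-modulus site transports `T k`; one-step data `R′ k` (`‖R′‖ ≤ 1`), `T′ k` (unit
modulus) with the COMP⁺ identities `T (k+1) = compT (T k) (T′ k)`, `Rc (k+1) = Rtr (R′ k)`; per-level global small-field frames `(G, c, m_G, m_B)`,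
`(G′, c′, m_G′, m_B′)` with `16d²(n m_G)² + 4m_B² ≤ ½` (and the primed one-step version); one-block mismatch `‖mis‖ ≤ m_k` with
`512d²(n m_k)² ≤ ½`; in-block k-block transport defect `w_k`; plaquette defect `a_k`; one-step in-block/face-crossing defects `m₁,k`; and the
CLASS bounds `n·w_k ≤ c_w`, `a_k·n² ≤ c_a`, `n²·m_k ≤ c_m`, `n²·m₁,k ≤ c₁`.  THEN the Hermitian effective covariant Laplacians
`X_k = effSc (L^k) M (Rc k) (T k) a₀` of King's charged scalar WITH background CONVERGE on the unit torus at RATE `L⁻¹`: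
`TowerLimitRate (fun _ ↦ 1) 1 X (cEnd d L c_w c_a c_m c₁) L⁻¹`, i.e. `‖X_k − X_∞‖ ≤ C·L^{−k}/(1 − L⁻¹)` — the route's target R⁺ of
`t4/skeletons/NE2-t4-ne2-p2.md` §0 for the scalar covariant species.  Per level the bracket is `VariationalCovariantScalarPairClosed.
scalar_pair_closed` (leaf-09-g3; UB⁺ leaf-04-g2, ONE⁺ leaf-01-g2, REG⁺ leaf-09-g3, FED⁺/P⁺/D the owner, COMP⁺/tower leaf-02-g3 — all BY
NAME).  NO leaf binder, NO NE3, NO `def … : Prop`, nothing printed is a hypothesis; MODEL LEVEL (transporters/frames/defects = DATA);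
NE2 NOT proved. [folklore] -/
theorem towerLimitRate_scalarTower_closed (hL : 2 ≤ L)
    -- tower data and COMP⁺
    (hT : ∀ k x, ‖T k x‖ = 1) (hRc1 : ∀ k y μ, ‖Rc k y μ‖ = 1) (hR' : ∀ k x μ, ‖R' k x μ‖ ≤ 1) (hT'1 : ∀ k x, ‖T' k x‖ = 1)
    (hTcomp : ∀ k, T (k + 1) = compT (L ^ k) L M (T k) (T' k)) (hRtr : ∀ k, Rc (k + 1) = Rtr (L ^ k) L M (R' k))
    -- P⁺ data (global frames) at every level and one step up
    (hG : ∀ k x, ‖G k x‖ = 1) (hc : ∀ k z, ‖c k z‖ ≤ 1)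
    (hframe : ∀ k x μ, ‖G k (x + unitVec (fine (L ^ k) M) μ) - G k x * Rc k x μ‖ ≤ mG k)
    (hblock : ∀ k z j, ‖G k (bpt (L ^ k) M z j) - c k z * T k (bpt (L ^ k) M z j)‖ ≤ mB k)
    (hsmall : ∀ k, 16 * (d : ℝ) ^ 2 * ((((L ^ k : ℕ)) : ℝ) * mG k) ^ 2 + 4 * mB k ^ 2 ≤ 1 / 2)
    (hG' : ∀ k x, ‖G' k x‖ = 1) (hc' : ∀ k y, ‖c' k y‖ ≤ 1)
    (hframe' : ∀ k x μ, ‖G' k (x + unitVec (fine L (fine (L ^ k) M)) μ) - G' k x * R' k x μ‖ ≤ mG' k)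
    (hblock' : ∀ k y j, ‖G' k (bpt L (fine (L ^ k) M) y j) - c' k y * T' k (bpt L (fine (L ^ k) M) y j)‖ ≤ mB' k)
    (hsmall' : ∀ k, 16 * (d : ℝ) ^ 2 * ((L : ℝ) * mG' k) ^ 2 + 4 * mB' k ^ 2 ≤ 1 / 2)
    -- FED⁺ data: one-block mismatch, absorbed
    (hm : ∀ k, 0 ≤ m k) (hmis : ∀ k y μ j, ‖mis L (fine (L ^ k) M) (Rc k) (R' k) (T' k) y μ j‖ ≤ m k)
    (habsorb : ∀ k, 512 * (d : ℝ) ^ 2 * ((((L ^ k : ℕ)) : ℝ) * m k) ^ 2 ≤ 1 / 2)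
    -- UB⁺ data: in-block k-block transport defect; REG⁺ data: plaquette defect
    (hw : ∀ k, 0 ≤ w k)
    (hwin : ∀ k (y : Tor M) (j : Fin d → Fin (L ^ k)) (μ : Fin d), (j μ : ℕ) + 1 < L ^ k →
      ‖Rc k (bpt (L ^ k) M y j) μ * (starRingEnd ℂ) (T k (bpt (L ^ k) M y j + unitVec (fine (L ^ k) M) μ)) * T k (bpt (L ^ k) M y j) - 1‖
        ≤ w k)
    (ha : ∀ k, 0 ≤ a k)
    (hP : ∀ k x μ ν, ‖Rc k x μ * Rc k (x + unitVec (fine (L ^ k) M) μ) ν - Rc k x ν * Rc k (x + unitVec (fine (L ^ k) M) ν) μ‖ ≤ a k)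
    -- ONE⁺ data: one-step in-block / face-crossing defects
    (hm₁ : ∀ k, 0 ≤ m₁ k)
    (hin : ∀ k (y : Tor (fine (L ^ k) M)) (j : Fin d → Fin L) (μ : Fin d), (j μ : ℕ) + 1 < L →
      ‖R' k (bpt L (fine (L ^ k) M) y j) μ * (starRingEnd ℂ) (T' k (bpt L (fine (L ^ k) M) y j + unitVec (fine L (fine (L ^ k) M)) μ))
          * T' k (bpt L (fine (L ^ k) M) y j) - 1‖ ≤ m₁ k)
    (hcross : ∀ k (y : Tor (fine (L ^ k) M)) (j : Fin d → Fin L) (μ : Fin d), (j μ : ℕ) + 1 = L →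
      ‖R' k (bpt L (fine (L ^ k) M) y j) μ * (starRingEnd ℂ) (T' k (bpt L (fine (L ^ k) M) y j + unitVec (fine L (fine (L ^ k) M)) μ))
          * T' k (bpt L (fine (L ^ k) M) y j) - Rc k y μ‖ ≤ m₁ k)
    -- CLASS (unit-scale-smooth small-field class; k-uniform constants)
    {cw ca cm c₁ : ℝ}
    (hwc : ∀ k, (((L ^ k : ℕ)) : ℝ) * w k ≤ cw) (hac : ∀ k, a k * (((L ^ k : ℕ)) : ℝ) ^ 2 ≤ ca)
    (hmc : ∀ k, (((L ^ k : ℕ)) : ℝ) ^ 2 * m k ≤ cm) (hm₁c : ∀ k, (((L ^ k : ℕ)) : ℝ) ^ 2 * m₁ k ≤ c₁)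
    {a₀ : ℝ} (ha₀ : 0 < a₀) :
    TowerLimitRate (ι := fun _ => Tor M) (fun _ => (1 : Matrix (Tor M) (Tor M) ℂ)) 1
      (fun k => effSc (L ^ k) M (Rc k) (T k) a₀) (cEnd d L cw ca cm c₁) ((L : ℝ)⁻¹) := by
  refine towerLimitRate_of_closedBrackets L M Rc T R' T' hL hT (CP' := fun _ => 1088 * (d : ℝ) + 128)
    (fun k f => qW_le_coarse (L ^ k) M (hG k) (hc k) (hframe k) (hblock k) (hsmall k) f) hTcomp hRtr ha₀ w a m m₁
    hw hwc ha hac hm hmc hm₁ hm₁c fun k μ => ?_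
  have h := scalar_pair_closed (L ^ k) L M (hG k) (hc k) (hframe k) (hblock k) (hsmall k) (hG' k) (hc' k) (hframe' k) (hblock' k)
    (hsmall' k) (hR' k) (hT'1 k) (hm k) (hmis k) (habsorb k) (hT k) (hRc1 k) (hw k) (hwin k) (ha k) (hP k) (hm₁ k) (hin k) (hcross k) μ
  simp only [eLevel, ePLevel, lamLevel, lamF, lamC, cR, eFED, eONE, eUB, delta, eps1, deltaP]
  simpa only using h

end Closed

end Summit.QuantumFields.BalabanUV.T4Continuum.VariationalCovariantEnd

end
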